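import Summits.CriticalPhenomena.SAWScalingLimit.Theses.SAWLoopAvoidanceChaos
import Literature.Probability.RandomPlanarGeometry.ConformalRestrictionProofs
import Literature.Probability.RandomPlanarGeometry.ConformalRestrictionCovariance
import Literature.Probability.RandomPlanarGeometry.LoopAvoidanceRegularisedLaw

/-!
# Constant counterterm ⇒ dilation covariance (special case of `stub_dilation`, line `similarity-tangent`)

For a CONSTANT counterterm `θ ≡ θ₀` the loop-avoidance scheme is exactly dilation covariant at the
level of cutoffs: the `(r ε)`-scheme in `r • D` is the image of the `ε`-scheme in `D` under
`z ↦ r z` (the mesh, the boxes, the discrete domain graph and its random-walk loop measure all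
scale; the SLE₂ law scales by conformal covariance of SLE). Hence every admissible limit family for
a constant counterterm is dilation covariant (uniqueness of weak limits).
-/

noncomputable section

namespace Summit.CriticalPhenomena.SAWScalingLimit.Cruxes.ChaosConformal.SimilarityTangent

open MeasureTheory Filter Topology Set
open scoped ENNReal NNReal
open Literature.Probability.RandomPlanarGeometry Literature.Probability.LatticeModels
open Summit.CriticalPhenomena.SAWScalingLimit.Theses

/-! ### 1. Lattice scaling: mesh `r δ` in `r • Ω` is mesh `δ` in `Ω` -/

section Lattice

variable {r : ℝ} (hr : 0 < r)

/-- The dilation `z ↦ r z` as a similarity of the plane. -/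
abbrev dil (r : ℝ) (hr : 0 < r) : ℂ ≃ₜ ℂ :=
  similarity (r : ℂ) (by exact_mod_cast hr.ne') 0

theorem dil_apply (z : ℂ) : dil r hr z = (r : ℂ) * z := by
  simp [similarity_apply]

theorem meshPoint_mul (δ : ℝ) (x : Site 2) :
    meshPoint (r * δ) x = (r : ℂ) * meshPoint δ x := by
  simp only [meshPoint, Complex.ofReal_mul, mul_assoc]

theorem meshVertices_dilate (Ω : Set ℂ) (δ : ℝ) :
    meshVertices (dil r hr '' Ω) (r * δ) = meshVertices Ω δ := by
  ext x
  simp only [mem_meshVertices_iff, meshPoint_mul]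
  constructor
  · rintro ⟨z, hz, hzx⟩
    rw [dil_apply] at hzx
    have hr' : (r : ℂ) ≠ 0 := by exact_mod_cast hr.ne'
    have : z = meshPoint δ x := mul_left_cancel₀ hr' hzx
    exact this ▸ hz
  · intro hx
    exact ⟨meshPoint δ x, hx, dil_apply hr _⟩

theorem image_segment_dil (a b : ℂ) :
    dil r hr '' segment ℝ a b = segment ℝ ((r : ℂ) * a) ((r : ℂ) * b) := by
  have h := image_segment ℝ ((r • LinearMap.id : ℂ →ₗ[ℝ] ℂ).toAffineMap) a b
  have hf : ⇑((r • LinearMap.id : ℂ →ₗ[ℝ] ℂ).toAffineMap) = fun z : ℂ => (r : ℂ) * z := by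
    funext z
    simp [Complex.real_smul]
  have hd : ⇑(dil r hr) = fun z : ℂ => (r : ℂ) * z := funext (dil_apply hr)
  rw [hd, ← hf, h, hf]

theorem meshGraph_dilate (Ω : Set ℂ) (δ : ℝ) :
    meshGraph (dil r hr '' Ω) (r * δ) = meshGraph Ω δ := by
  ext x y
  simp only [meshGraph_adj_iff, meshPoint_mul, ← image_segment_dil hr,
    ← (dil r hr).image_closure, Set.image_subset_image_iff (dil r hr).injective]

theorem meshDomain_dilate (Ω : Set ℂ) (δ : ℝ) :
    meshDomain (dil r hr '' Ω) (r * δ) = meshDomain Ω δ := by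
  have key : ∀ (V : Set (Site 2)) (G : SimpleGraph (Site 2)), V = meshVertices Ω δ →
      G = meshGraph Ω δ →
      (⋃ (C : (G.induce V).ConnectedComponent)
        (_ : ∀ C' : (G.induce V).ConnectedComponent, C'.supp.ncard ≤ C.supp.ncard),
        Subtype.val '' C.supp) = meshDomain Ω δ := by
    rintro V G rfl rfl
    rfl
  exact key _ _ (meshVertices_dilate hr Ω δ) (meshGraph_dilate hr Ω δ)

theorem discreteDomainGraph_dilate (Ω : Set ℂ) (δ : ℝ) :
    discreteDomainGraph (dil r hr '' Ω) (r * δ) = discreteDomainGraph Ω δ := by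
  ext x y
  simp only [discreteDomainGraph_adj_iff, meshGraph_dilate, meshDomain_dilate]

end Lattice


/-! ### 2. Boxes, hit sets and the density scale (constant counterterm) -/

section Scheme

variable {r : ℝ} (hr : 0 < r)

theorem re_ofReal_mul' (a : ℝ) (z : ℂ) : ((a : ℂ) * z).re = a * z.re := by simp
theorem im_ofReal_mul' (a : ℝ) (z : ℂ) : ((a : ℂ) * z).im = a * z.im := by simp

theorem box_dilate (δ : ℝ) (x : Site 2) :
    LoopAvoidance.box (r * δ) x = dil r hr '' LoopAvoidance.box δ x := by
  ext z
  simp only [LoopAvoidance.mem_box, Set.mem_image]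
  constructor
  · rintro ⟨h1, h2⟩
    refine ⟨(r : ℂ)⁻¹ * z, ⟨?_, ?_⟩, ?_⟩
    · have e : ((r : ℂ)⁻¹ * z).re = r⁻¹ * z.re := by
        rw [show ((r : ℂ)⁻¹) = ((r⁻¹ : ℝ) : ℂ) by push_cast; ring, re_ofReal_mul']
      rw [e]
      have : r⁻¹ * z.re - δ * ((x 0 : ℤ) : ℝ) = r⁻¹ * (z.re - r * δ * ((x 0 : ℤ) : ℝ)) := by
        field_simp
      rw [this, abs_mul, abs_of_pos (inv_pos.2 hr)]
      rw [show δ / 2 = r⁻¹ * (r * δ / 2) by field_simp]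
      exact mul_le_mul_of_nonneg_left h1 (inv_pos.2 hr).le
    · have e : ((r : ℂ)⁻¹ * z).im = r⁻¹ * z.im := by
        rw [show ((r : ℂ)⁻¹) = ((r⁻¹ : ℝ) : ℂ) by push_cast; ring, im_ofReal_mul']
      rw [e]
      have : r⁻¹ * z.im - δ * ((x 1 : ℤ) : ℝ) = r⁻¹ * (z.im - r * δ * ((x 1 : ℤ) : ℝ)) := by
        field_simp
      rw [this, abs_mul, abs_of_pos (inv_pos.2 hr)]
      rw [show δ / 2 = r⁻¹ * (r * δ / 2) by field_simp]
      exact mul_le_mul_of_nonneg_left h2 (inv_pos.2 hr).le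
    · rw [dil_apply, ← mul_assoc, mul_inv_cancel₀ (by exact_mod_cast hr.ne' : (r : ℂ) ≠ 0),
        one_mul]
  · rintro ⟨w, ⟨h1, h2⟩, rfl⟩
    rw [dil_apply, re_ofReal_mul', im_ofReal_mul']
    constructor
    · have : r * w.re - r * δ * ((x 0 : ℤ) : ℝ) = r * (w.re - δ * ((x 0 : ℤ) : ℝ)) := by ring
      rw [this, abs_mul, abs_of_pos hr, show r * δ / 2 = r * (δ / 2) by ring]
      exact mul_le_mul_of_nonneg_left h1 hr.le
    · have : r * w.im - r * δ * ((x 1 : ℤ) : ℝ) = r * (w.im - δ * ((x 1 : ℤ) : ℝ)) := by ring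
      rw [this, abs_mul, abs_of_pos hr, show r * δ / 2 = r * (δ / 2) by ring]
      exact mul_le_mul_of_nonneg_left h2 hr.le

theorem hit_dilate (D : DobrushinDomain) (δ : ℝ) (γ : CurveClass ℂ) :
    LoopAvoidance.hit (D.map (dil r hr)) (r * δ) (CurveClass.map (dil r hr : C(ℂ, ℂ)) γ) =
      LoopAvoidance.hit D δ γ := by
  ext x
  simp only [LoopAvoidance.mem_hit, MarkedDomain.carrier_map, meshDomain_dilate, box_dilate hr,
    CurveClass.range_map]
  have himg : ((dil r hr : C(ℂ, ℂ)) : ℂ → ℂ) '' γ.range = dil r hr '' γ.range := rfl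
  rw [himg, ← Set.image_inter (dil r hr).injective, Set.image_nonempty]

theorem dens_dilate (D : DobrushinDomain) (θ₀ δ : ℝ) (γ : CurveClass ℂ) :
    LoopAvoidance.dens (D.map (dil r hr)) (fun _ => θ₀) (r * δ)
        (CurveClass.map (dil r hr : C(ℂ, ℂ)) γ) =
      LoopAvoidance.dens D (fun _ => θ₀) δ γ := by
  simp only [LoopAvoidance.dens, hit_dilate hr, MarkedDomain.carrier_map,
    discreteDomainGraph_dilate hr]

end Scheme


/-! ### 3. The regularised law scales, and the limit is dilation covariant -/

section Limit

variable {r : ℝ} (hr : 0 < r)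

/-- Push-forward of a reweighted law along a measurable map: `(F_* μ).withDensity h =
F_* (μ.withDensity (h ∘ F))`. [folklore] -/
theorem withDensity_map_eq {α β : Type*} [MeasurableSpace α] [MeasurableSpace β] (μ : Measure α)
    {F : α → β} (hF : Measurable F) {h : β → ℝ≥0∞} (hh : Measurable h) :
    (μ.map F).withDensity h = (μ.withDensity (h ∘ F)).map F := by
  ext s hs
  rw [withDensity_apply _ hs, setLIntegral_map hs hh hF, Measure.map_apply hF hs,
    withDensity_apply _ (hF hs)]
  rfl

/-- **Exact cutoff-level dilation covariance for a constant counterterm**: the `(r δ)`-scheme in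
`r • D` driven by the image law is the image of the `δ`-scheme in `D`. [folklore] -/
theorem regularisedLaw_dilate (D : DobrushinDomain) (θ₀ : ℝ) (μ : Measure (CurveClass ℂ))
    {δ : ℝ} (hδ : 0 < δ) :
    LoopAvoidance.regularisedLaw (D.map (dil r hr)) (fun _ => θ₀)
        (μ.map (CurveClass.map (dil r hr : C(ℂ, ℂ)))) (r * δ) =
      (LoopAvoidance.regularisedLaw D (fun _ => θ₀) μ δ).map (CurveClass.map (dil r hr : C(ℂ, ℂ))) := by
  set F : CurveClass ℂ → CurveClass ℂ := CurveClass.map (dil r hr : C(ℂ, ℂ)) with hF_def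
  have hF : Measurable F := CurveClass.measurable_map _
  have hrδ : 0 < r * δ := mul_pos hr hδ
  set h' : CurveClass ℂ → ℝ≥0∞ := fun γ =>
    ENNReal.ofReal (LoopAvoidance.dens (D.map (dil r hr)) (fun _ => θ₀) (r * δ) γ) with hh'_def
  have hh' : Measurable h' :=
    (LoopAvoidance.measurable_dens (D.map (dil r hr)) (fun _ => θ₀) (r * δ) hrδ).ennreal_ofReal
  have hcomp : h' ∘ F = fun γ => ENNReal.ofReal (LoopAvoidance.dens D (fun _ => θ₀) δ γ) := by
    funext γ
    simp only [Function.comp_apply, hh'_def, hF_def, dens_dilate hr]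
  unfold LoopAvoidance.regularisedLaw
  change (∫⁻ γ, h' γ ∂(μ.map F))⁻¹ • (μ.map F).withDensity h' =
    ((∫⁻ γ, ENNReal.ofReal (LoopAvoidance.dens D (fun _ => θ₀) δ γ) ∂μ)⁻¹ •
      μ.withDensity (fun γ => ENNReal.ofReal (LoopAvoidance.dens D (fun _ => θ₀) δ γ))).map F
  rw [lintegral_map hh' hF, withDensity_map_eq μ hF hh', Measure.map_smul, hcomp]
  have hpt : ∀ a, h' (F a) = ENNReal.ofReal (LoopAvoidance.dens D (fun _ => θ₀) δ a) :=
    fun a => congrFun hcomp a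
  simp only [hpt]

/-- Uniqueness of weak limits in difference form (Billingsley 1999, Thm 1.2). [folklore] -/
theorem eq_of_tendsto_of_eventually_abs_sub_lt' {u v : ℝ → ℝ} {A B : ℝ}
    (hu : Tendsto u (𝓝[>] (0 : ℝ)) (𝓝 A)) (hv : Tendsto v (𝓝[>] (0 : ℝ)) (𝓝 B))
    (huv : ∀ η : ℝ, 0 < η → ∀ᶠ ε in 𝓝[>] (0 : ℝ), |u ε - v ε| < η) : A = B := by
  have h0 : Tendsto (fun ε => u ε - v ε) (𝓝[>] (0 : ℝ)) (𝓝 0) := by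
    rw [Metric.tendsto_nhds]
    intro η hη
    filter_upwards [huv η hη] with ε hε
    rwa [Real.dist_eq, sub_zero]
  have h1 : Tendsto (fun ε => u ε - v ε) (𝓝[>] (0 : ℝ)) (𝓝 (A - B)) := hu.sub hv
  exact sub_eq_zero.1 (tendsto_nhds_unique h1 h0)

/-- Weak-limit transport (as in the line file, duplicated to keep this file import-clean). -/
theorem map_eq_of_schemeCompare' {μ μ' : ℝ → Measure (CurveClass ℂ)} {ν ν' : Measure (CurveClass ℂ)}
    [IsProbabilityMeasure ν] [IsProbabilityMeasure ν'] (F : C(ℂ, ℂ))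
    (hμ : TendstoLaw (fun (_ : ℝ) (x : CurveClass ℂ) => x) μ id ν)
    (hμ' : TendstoLaw (fun (_ : ℝ) (x : CurveClass ℂ) => x) μ' id ν')
    (hcmp : ∀ (f : BoundedContinuousFunction (CurveClass ℂ) ℝ) (η : ℝ), 0 < η →
      ∀ᶠ ε in 𝓝[>] (0 : ℝ),
        |(∫ x, f x ∂((μ ε).map (CurveClass.map F))) - ∫ x, f x ∂(μ' ε)| < η) :
    ν' = ν.map (CurveClass.map F) := by
  have hFm : Measurable (CurveClass.map F) := CurveClass.measurable_map F
  haveI : IsProbabilityMeasure (ν.map (CurveClass.map F)) :=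
    Measure.isProbabilityMeasure_map hFm.aemeasurable
  refine (ext_of_forall_integral_eq_of_IsFiniteMeasure fun f => ?_).symm
  let fF : BoundedContinuousFunction (CurveClass ℂ) ℝ :=
    f.compContinuous ⟨CurveClass.map F, CurveClass.continuous_map F⟩
  have hA : Tendsto (fun ε => ∫ x, f x ∂((μ ε).map (CurveClass.map F))) (𝓝[>] (0 : ℝ))
      (𝓝 (∫ x, f x ∂(ν.map (CurveClass.map F)))) := by
    have h := hμ fF
    have e1 : ∀ ρ : Measure (CurveClass ℂ),
        ∫ x, f x ∂(ρ.map (CurveClass.map F)) = ∫ ω, fF ω ∂ρ := by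
      intro ρ
      rw [integral_map hFm.aemeasurable f.continuous.aestronglyMeasurable]
      rfl
    simp_rw [e1]
    simpa only [id] using h
  have hB : Tendsto (fun ε => ∫ x, f x ∂(μ' ε)) (𝓝[>] (0 : ℝ)) (𝓝 (∫ x, f x ∂ν')) := by
    have h := hμ' f
    simpa only [id] using h
  exact eq_of_tendsto_of_eventually_abs_sub_lt' hA hB (hcmp f)

/-- **Constant counterterm ⇒ dilation covariance of every admissible limit.** If `θ ≡ θ₀`, the SLE₂
family is given and `reg_ε^D(θ) → Q D` weakly in every Dobrushin domain (`Q` chordal), then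
`Q (r • D) = (z ↦ r z)_* Q D` for every `r > 0`. (The simplicity / boundary-avoidance clause of the
route's admissibility block is not needed.) [folklore] -/
theorem dilationCovariance_of_const (θ₀ : ℝ) (sle2 : ChordalFamily)
    (hsle2 : ∀ D : DobrushinDomain, IsSLELaw 2 D (sle2 D)) (Q : ChordalFamily) (hQ : Q.IsChordal)
    (hconv : ∀ D : DobrushinDomain, TendstoLaw (fun (_ : ℝ) (x : CurveClass ℂ) => x)
      (LoopAvoidance.regularisedLaw D (fun _ => θ₀) (sle2 D)) id (Q D))
    (D : DobrushinDomain) (r : ℝ) (hr' : (r : ℂ) ≠ 0) (hr : 0 < r) :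
    Q (D.map (similarity (r : ℂ) hr' 0)) =
      (Q D).map (CurveClass.map (similarity (r : ℂ) hr' 0 : C(ℂ, ℂ))) := by
  -- the SLE₂ family is similarity covariant (conformal covariance of SLE, proved in the tree)
  have hsle : sle2 (D.map (dil r hr)) = (sle2 D).map (CurveClass.map (dil r hr : C(ℂ, ℂ))) :=
    (ChordalFamily.isConformallyCovariant_of_isSLELaw hsle2).isSimilarityCovariant D (r : ℂ)
      (by exact_mod_cast hr.ne') 0
  -- exact identity of the schemes for every cutoff
  have hid : ∀ ε : ℝ, 0 < ε →
      LoopAvoidance.regularisedLaw (D.map (dil r hr)) (fun _ => θ₀) (sle2 (D.map (dil r hr))) ε =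
        (LoopAvoidance.regularisedLaw D (fun _ => θ₀) (sle2 D) (ε / r)).map
          (CurveClass.map (dil r hr : C(ℂ, ℂ))) := by
    intro ε hε
    have h := regularisedLaw_dilate hr D θ₀ (sle2 D) (div_pos hε hr)
    rw [mul_div_cancel₀ ε hr.ne'] at h
    rw [hsle, h]
  haveI : IsProbabilityMeasure (Q D) := (hQ D).1
  haveI : IsProbabilityMeasure (Q (D.map (dil r hr))) := (hQ _).1
  -- reparametrised convergence in `D`
  have hdiv : Tendsto (fun ε : ℝ => ε / r) (𝓝[>] (0 : ℝ)) (𝓝[>] (0 : ℝ)) := by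
    refine tendsto_nhdsWithin_iff.2 ⟨?_, ?_⟩
    · have h : Tendsto (fun ε : ℝ => ε / r) (𝓝 (0 : ℝ)) (𝓝 (0 / r)) :=
        tendsto_id.div_const r
      rw [zero_div] at h
      exact h.mono_left nhdsWithin_le_nhds
    · exact eventually_nhdsWithin_of_forall fun ε hε => div_pos hε hr
  have hμ : TendstoLaw (fun (_ : ℝ) (x : CurveClass ℂ) => x)
      (fun ε => LoopAvoidance.regularisedLaw D (fun _ => θ₀) (sle2 D) (ε / r)) id (Q D) :=
    fun f => (hconv D f).comp hdiv
  have key := map_eq_of_schemeCompare' (μ' := LoopAvoidance.regularisedLaw (D.map (dil r hr))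
      (fun _ => θ₀) (sle2 (D.map (dil r hr)))) (dil r hr : C(ℂ, ℂ)) hμ (hconv (D.map (dil r hr)))
      (fun f η hη => by
        filter_upwards [self_mem_nhdsWithin] with ε hε
        rw [← hid ε hε, sub_self, abs_zero]
        exact hη)
  exact key

end Limit

end Summit.CriticalPhenomena.SAWScalingLimit.Cruxes.ChaosConformal.SimilarityTangent
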